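import Summits.HodgeConjecture.HodgeConjecture.Theorems.R90S2ArchPureTensor      -- ★ p864344 CARD 2: `archTensor`, `archTensor_apply`
import Literature.NumberTheory.Rogawski1990.ArchimedeanTransfer                    -- ★ `ArchSmooth` (the archimedean test class BY RESTRICTION from `GL_N(L ⊗ ℝ)`)
import Literature.NumberTheory.Automorphic.GLnCuspidalSpectrumSiegelProofs         -- ★ `finiteDimensional_matrix_mixedSpace`, `contDiff_exp_matrix_mixedSpace`
import Mathlib.Geometry.Manifold.PartitionOfUnity
import Mathlib.Geometry.Manifold.ContMDiff.NormedSpace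
import HarnessLib

/-!
# R90-TF ∕ S2 «Ch. 12 archimedean block» — CARD 2 §3′ `R90S2ArchSmoothTensor`: PURE TENSORS OF AMBIENT-SMOOTH LOCAL FACTORS ARE `ArchSmooth` (generic `N`, `H`)

Cell `pub/hodgecm-mathlib`, HCML Track R90-TF, section S2 (base `R90-C11`); crux h413 = `stmt-HodgeConjecture-24833`, route of record `HCCMUnconditional`.
Hand: prover seat hodgecm-mathlib-K2E3-p25 (g5); dealer K2E1b-plan (g8) «TAKE §3′» (R90∕K2 bus 2026-09-05T02:16:24Z (2), head bytes verbatim below); census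
2026-09-05T02:10:18Z.  THEOREMS ONLY (proof lane); NO def, NO socket, NO instance, NO notation, NO `sorry`, default heartbeats.  E-grade: Mathlib + ★ CARD 2 + ★
`ArchimedeanTransfer` (`ArchSmooth`) + ★ `GLnCuspidalSpectrumSiegelProofs` (the finite-dimensionality constant and the smooth matrix exponential) — light closure
(the ★ `(3, Matrix.diagonal α)` chain `ArchSmoothTensor` ∕ `ArchBouazizPositiveTestFunctionG` is NOT imported: +184 modules of the Bouaziz chart road).

## WHAT IS PROVED

* §1 (pure Mathlib) `exists_contDiff_one_of_isCompact` — the AMBIENT PLATEAU: on a finite-dimensional real normed space, for `K` compact inside `U` open there is a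
  `C^∞` `χ : E → ℝ` with compact support, `tsupport χ ⊆ U`, `χ = 1` on `K`, `0 ≤ χ ≤ 1` (Mathlib's manifold partition of unity
  `exists_contMDiffMap_one_nhds_of_subset_interior` on the model space, read back through `contMDiff_iff_contDiff`).
* §2 (generic `N`, `H`) `contDiff_placeMatrix` — the place-`w` coordinate matrix `X ↦ ((X_{ij})_w)` on `M_N(L ⊗ ℝ)` is `C^∞` (ℝ-linear); `coe_archPiEquivCM_apply` — the entries
  of the place component `g_w = archPiEquivCM g w` ARE those coordinates (★ `coe_archAt_apply`, definitional); `archTensor_eq_ambient` — a pure tensor of factors that are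
  restrictions of ambient functions `fa_w` on `M_N(ℂ)` is the restriction of the ambient product `Θ(X) = ∏_w fa_w((X_{ij})_w)`; `contDiff_ambientProd`.
* §3 **`archSmooth_archTensor`** (the dealer's head, token for token):
  `(φ : ∀ w, C_c(↥(archLocal L N H w), ℂ)) (fa : ∀ w, Matrix (Fin N) (Fin N) ℂ → ℂ) (hfa : ∀ w, ContDiff ℝ ∞ (fa w)) (hφ : ∀ w g, φ w g = fa w ↑↑g) : ArchSmooth L N H ⇑(archTensor L H φ)`.
  PROOF: the witness on `GL_N(L ⊗ ℝ)` is `g ↦ χ(g) · Θ(g)` with `χ` the §1 plateau equal to `1` on the (compact) image of `tsupport (⊗ φ)` and compactly supported INSIDE the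
  open set of units (so the witness has compact support in `GL_N(L ⊗ ℝ)`: Mathlib `Units.isOpenEmbedding_val` + `IsInducing.isCompact_preimage'`); it is continuous, smooth along
  `X ↦ y · exp X` (★ `contDiff_exp_matrix_mixedSpace`), and restricts to `⊗ φ` on `U(H)(L ⊗ ℝ)` (on the support `χ = 1`; off it both sides vanish).  Compact support of `⊗ φ`
  is free (`C_c`).  Corollary `archSmooth_archTensor_update` (the `w`-component replaced by an ambient-smooth `ψ`).

CONSUMER BY NAME: the T2 assembly `R90S2ArchBlockPacketCuspOfLetters` — its named hypothesis «`ArchSmooth L 3 (phi3 L) ⇑(f k)` for pure tensors» is this head applied to the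
letters' local smoothness currency of record `IsArchLocSmooth L H w φ := ∃ fa, ContDiff ℝ ∞ fa ∧ ∀ g, φ g = fa ↑↑g` (typ2's `R90S2ArchBlockPairLetterDefs` §0, dealer
02:16:24Z (3)): `(fa, hfa, hφ)` ARE its unfolding.  NOT HERE: the `H_∞` twin `ArchSmooth₂ L ⇑(archTensor₂ L (phi2 L) (phi1 L) φ₂)` (needs the block read-back of ★ `endoEmbArch`
in the ambient `M₃(L ⊗ ℝ)` frame — census owed, second file).

HONEST LABEL: calculus plumbing; pays NO printed input; HC_CM is proved only modulo the 7 printed citations (2 remaining named inputs: hLiu418 = `stmt-HodgeConjecture-24832`,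
h413 = `stmt-HodgeConjecture-24833`) until rung 0 closes.  Count-neutral helper (`--supports stmt-HodgeConjecture-24833 --as helper`).

References: [BorelJacquet1979] §1.1, §4.1 (`C_c^∞(G_∞)`, tensors over the places); [Rogawski1990] §14.2 p. 233 (`f′_∞ = ⊗_v f′_v ∈ C_c^∞(G′_∞)`), §13.8 p. 218 L20–28.
-/

set_option autoImplicit false
set_option linter.dupNamespace false

noncomputable section

open NumberField NumberField.InfinitePlace NumberField.mixedEmbedding CompactlySupported Set Filter Topology Function
open scoped Matrix MatrixGroups Classical ContDiff Manifold
open Literature.NumberTheory.Automorphic Literature.NumberTheory.Automorphic.UnitaryGroup Literature.NumberTheory.Rogawski1990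

namespace Summit.HodgeConjecture.HodgeConjecture.R90.S2

/-! ## §1 The ambient plateau on a finite-dimensional real normed space (pure Mathlib) -/

section Plateau

/-- **AMBIENT PLATEAU**: in a finite-dimensional real normed space, for `K` compact inside `U` open there is a `C^∞` function `χ` with compact support, `tsupport χ ⊆ U`,
`χ = 1` on `K` and `0 ≤ χ ≤ 1` (Mathlib's smooth partitions of unity on the model manifold `𝓘(ℝ, E)`, between `K` and a compact neighbourhood of `K` inside `U`).
[cite: BorelJacquet1979, §1.1] -/
theorem exists_contDiff_one_of_isCompact {E : Type*} [NormedAddCommGroup E] [NormedSpace ℝ E] [FiniteDimensional ℝ E]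
    {K U : Set E} (hK : IsCompact K) (hU : IsOpen U) (hKU : K ⊆ U) :
    ∃ χ : E → ℝ, ContDiff ℝ ∞ χ ∧ HasCompactSupport χ ∧ tsupport χ ⊆ U ∧ (∀ x ∈ K, χ x = 1) ∧ ∀ x, χ x ∈ Icc (0 : ℝ) 1 := by
  obtain ⟨V, hVo, hKV, hVU, hVc⟩ := exists_open_between_and_isCompact_closure hK hU hKU
  have hKint : K ⊆ interior (closure V) := hKV.trans (interior_maximal subset_closure hVo)
  obtain ⟨f, h1, h0, h01⟩ := exists_contMDiffMap_one_nhds_of_subset_interior 𝓘(ℝ, E) hK.isClosed hKint (n := (⊤ : ℕ∞))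
  refine ⟨f, ?_, ?_, ?_, fun x hx => h1.self_of_nhdsSet x hx, h01⟩
  · exact contMDiff_iff_contDiff.1 f.contMDiff
  · exact HasCompactSupport.intro' hVc isClosed_closure h0
  · refine (closure_minimal (fun x hx => ?_) isClosed_closure).trans hVU
    by_contra hx'
    exact hx (h0 x hx')

end Plateau

/-! ## §2 The ambient product on `M_N(L ⊗ ℝ)` and the place coordinates -/

section Ambient

variable (L : Type) [Field L] [NumberField L] [IsCMField L] {N : ℕ} (H : Matrix (Fin N) (Fin N) L)

-- the scoped `ℓ^∞`-operator norm on `M_N(L ⊗ ℝ)` (the one through which ★ `IsArchSmooth` ∕ ★ `contDiff_exp_matrix_mixedSpace` are read)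
open scoped Matrix.Norms.Operator

omit [IsCMField L] in
/-- The place-`w` coordinate matrix `X ↦ ((X_{ij})_w)_{ij} : M_N(L ⊗ ℝ) → M_N(ℂ)` is `C^∞` (an `ℝ`-linear map on a finite-dimensional space). [cite: BorelJacquet1979, §4.1] -/
theorem contDiff_placeMatrix (w : {w : InfinitePlace L // w.IsComplex}) :
    ContDiff ℝ ∞ fun X : Matrix (Fin N) (Fin N) (mixedSpace L) => (Matrix.of fun i j => (X i j).2 w : Matrix (Fin N) (Fin N) ℂ) := by
  -- `M_N(L ⊗ ℝ)` is finite-dimensional over `ℝ` (★ named constant of `GLnCuspidalSpectrumSiegelProofs`, size-1 instance term under the scoped operator norm)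
  haveI : FiniteDimensional ℝ (Matrix (Fin N) (Fin N) (mixedSpace L)) := finiteDimensional_matrix_mixedSpace
  exact (LinearMap.toContinuousLinearMap
    (⟨⟨fun X : Matrix (Fin N) (Fin N) (mixedSpace L) => (Matrix.of fun i j => (X i j).2 w : Matrix (Fin N) (Fin N) ℂ), fun _ _ => rfl⟩, fun _ _ => rfl⟩ :
      Matrix (Fin N) (Fin N) (mixedSpace L) →ₗ[ℝ] Matrix (Fin N) (Fin N) ℂ)).contDiff

omit [IsCMField L] in
/-- The AMBIENT PRODUCT `Θ(X) = ∏_w fa_w((X_{ij})_w)` of `C^∞` functions `fa_w` on `M_N(ℂ)` is `C^∞` on `M_N(L ⊗ ℝ)`. [cite: BorelJacquet1979, §4.1] -/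
theorem contDiff_ambientProd (fa : {w : InfinitePlace L // w.IsComplex} → Matrix (Fin N) (Fin N) ℂ → ℂ) (hfa : ∀ w, ContDiff ℝ ∞ (fa w)) :
    ContDiff ℝ ∞ fun X : Matrix (Fin N) (Fin N) (mixedSpace L) => ∏ w, fa w (Matrix.of fun i j => (X i j).2 w) :=
  contDiff_prod fun w _ => (hfa w).comp (contDiff_placeMatrix L w)

/-- The entries of the place component `g_w = archPiEquivCM g w` are the `w`-coordinates of the entries of `g ∈ U(H)(L ⊗ ℝ) ≤ GL_N(L ⊗ ℝ)` (★ `coe_archAt_apply`, definitional).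
[cite: Rogawski1990, §14.2 p. 233] -/
theorem coe_archPiEquivCM_apply (g : ↥(arch (↥(maximalRealSubfield L)) L (IsCMField.complexConj L) N H)) (w : {w : InfinitePlace L // w.IsComplex}) (i j : Fin N) :
    (((archPiEquivCM L H (N := N) g w : ↥(archLocal L N H w)) : GL (Fin N) ℂ) : Matrix (Fin N) (Fin N) ℂ) i j =
      (((g : GL (Fin N) (mixedSpace L)) : Matrix (Fin N) (Fin N) (mixedSpace L)) i j).2 w :=
  rfl

/-- The place component as the coordinate matrix of the ambient matrix: `↑↑(g_w) = ((↑↑g)_{ij})_w`. [cite: Rogawski1990, §14.2 p. 233] -/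
theorem coe_archPiEquivCM_eq_of (g : ↥(arch (↥(maximalRealSubfield L)) L (IsCMField.complexConj L) N H)) (w : {w : InfinitePlace L // w.IsComplex}) :
    (((archPiEquivCM L H (N := N) g w : ↥(archLocal L N H w)) : GL (Fin N) ℂ) : Matrix (Fin N) (Fin N) ℂ) =
      Matrix.of fun i j => ((((g : GL (Fin N) (mixedSpace L)) : Matrix (Fin N) (Fin N) (mixedSpace L)) i j).2 w) :=
  Matrix.ext fun i j => by rw [Matrix.of_apply]; exact coe_archPiEquivCM_apply L H g w i j

/-- **A pure tensor of restricted ambient factors IS the restriction of the ambient product**: if `φ_w = fa_w ∘ (↑↑·)` on `U(σ_w H)(ℂ)` then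
`(⊗ φ)(k) = ∏_w fa_w(((↑↑k)_{ij})_w)`. [cite: BorelJacquet1979, §4.1] [cite: Rogawski1990, §14.2 p. 233] -/
theorem archTensor_eq_ambient (φ : ∀ w : {w : InfinitePlace L // w.IsComplex}, C_c(↥(archLocal L N H w), ℂ))
    (fa : {w : InfinitePlace L // w.IsComplex} → Matrix (Fin N) (Fin N) ℂ → ℂ)
    (hφ : ∀ w (g : ↥(archLocal L N H w)), φ w g = fa w ((g : GL (Fin N) ℂ) : Matrix (Fin N) (Fin N) ℂ))
    (k : ↥(arch (↥(maximalRealSubfield L)) L (IsCMField.complexConj L) N H)) :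
    archTensor L H φ k = ∏ w, fa w (Matrix.of fun i j => ((((k : GL (Fin N) (mixedSpace L)) : Matrix (Fin N) (Fin N) (mixedSpace L)) i j).2 w)) := by
  rw [archTensor_apply]
  exact Finset.prod_congr rfl fun w _ => by rw [hφ, coe_archPiEquivCM_eq_of]

end Ambient

/-! ## §3 Pure tensors of ambient-smooth local factors are `ArchSmooth` -/

section Smooth

variable (L : Type) [Field L] [NumberField L] [IsCMField L] {N : ℕ} (H : Matrix (Fin N) (Fin N) L)

open scoped Matrix.Norms.Operator

/-- **PURE TENSORS OF AMBIENT-SMOOTH LOCAL FACTORS ARE IN `C_c^∞(U(H)(L ⊗ ℝ))`** (dealer's head §3′, token for token): if every local factor `φ_w ∈ C_c(U(σ_w H)(ℂ), ℂ)` is the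
restriction of a `C^∞` function `fa_w` on `M_N(ℂ)`, then `⊗_w φ_w` is ★ `ArchSmooth L N H`.  Witness on `GL_N(L ⊗ ℝ)`: `g ↦ χ(g) · ∏_w fa_w((g_{ij})_w)` with `χ` the ambient
plateau of §1, `= 1` on the image of `tsupport (⊗ φ)` and compactly supported INSIDE the units (so the witness has compact support in `GL_N(L ⊗ ℝ)`), smooth along
`X ↦ y · exp X` by ★ `contDiff_exp_matrix_mixedSpace`. [cite: BorelJacquet1979, §4.1] [cite: Rogawski1990, §14.2 p. 233] -/
theorem archSmooth_archTensor (φ : ∀ w : {w : InfinitePlace L // w.IsComplex}, C_c(↥(archLocal L N H w), ℂ))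
    (fa : ∀ w : {w : InfinitePlace L // w.IsComplex}, Matrix (Fin N) (Fin N) ℂ → ℂ) (hfa : ∀ w, ContDiff ℝ ∞ (fa w))
    (hφ : ∀ w (g : ↥(archLocal L N H w)), φ w g = fa w ((g : GL (Fin N) ℂ) : Matrix (Fin N) (Fin N) ℂ)) :
    ArchSmooth L N H ⇑(archTensor L H φ) := by
  -- `M_N(L ⊗ ℝ)` is finite-dimensional over `ℝ` (★ named constant; needed by the §1 plateau)
  haveI : FiniteDimensional ℝ (Matrix (Fin N) (Fin N) (mixedSpace L)) := finiteDimensional_matrix_mixedSpace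
  -- the compact image of the support inside the open set of units
  have hoe := Units.isOpenEmbedding_val (R := Matrix (Fin N) (Fin N) (mixedSpace L))
  set K : Set (Matrix (Fin N) (Fin N) (mixedSpace L)) :=
    (fun k : ↥(arch (↥(maximalRealSubfield L)) L (IsCMField.complexConj L) N H) => ((k : GL (Fin N) (mixedSpace L)) : Matrix (Fin N) (Fin N) (mixedSpace L))) ''
      tsupport ⇑(archTensor L H φ) with hKdef
  have hKc : IsCompact K := (archTensor L H φ).hasCompactSupport.isCompact.image (Units.continuous_val.comp continuous_subtype_val)
  have hKU : K ⊆ range (Units.val : GL (Fin N) (mixedSpace L) → Matrix (Fin N) (Fin N) (mixedSpace L)) := by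
    rintro _ ⟨k, -, rfl⟩
    exact ⟨(k : GL (Fin N) (mixedSpace L)), rfl⟩
  obtain ⟨χ, hχ, hχs, hχU, hχK, -⟩ := exists_contDiff_one_of_isCompact hKc hoe.isOpen_range hKU
  -- the ambient product
  have hΘ := contDiff_ambientProd L fa hfa
  -- the witness
  refine ⟨fun g => (χ (g : Matrix (Fin N) (Fin N) (mixedSpace L)) : ℂ) *
      ∏ w, fa w (Matrix.of fun i j => (((g : Matrix (Fin N) (Fin N) (mixedSpace L)) i j).2 w)), ?_, ?_, fun y => ?_, fun k => ?_⟩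
  · -- continuity
    exact ((Complex.continuous_ofReal.comp hχ.continuous).comp Units.continuous_val).mul (hΘ.continuous.comp Units.continuous_val)
  · -- compact support: inside the pull-back of `tsupport χ ⊆ units`, compact by the open embedding `GL_N ↪ M_N`
    refine HasCompactSupport.intro' (hoe.isInducing.isCompact_preimage' hχs.isCompact hχU) ((isClosed_tsupport χ).preimage Units.continuous_val) ?_
    intro g hg
    have h0 : χ (g : Matrix (Fin N) (Fin N) (mixedSpace L)) = 0 := by
      by_contra h
      exact hg (subset_tsupport χ h)
    rw [h0, Complex.ofReal_zero, zero_mul]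
  · -- smoothness along `X ↦ y · exp X`
    -- Mathlib idiom (Mathlib/Algebra/Lie/OfAssociative.lean): the Lie structure on `M_N(L ⊗ ℝ)` through which ★ `archGroupGL` speaks
    letI : LieRing (Matrix (Fin N) (Fin N) (mixedSpace L)) := LieRing.ofAssociativeRing
    letI : LieAlgebra ℝ (Matrix (Fin N) (Fin N) (mixedSpace L)) := LieAlgebra.ofAssociativeAlgebra
    show ContDiff ℝ ∞ fun X : (archGroupGL N L).lie.toSubmodule =>
      (χ ((((y : GL (Fin N) (mixedSpace L)) * expGL (X : Matrix (Fin N) (Fin N) (mixedSpace L)) : GL (Fin N) (mixedSpace L)) :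
          Matrix (Fin N) (Fin N) (mixedSpace L))) : ℂ) *
        ∏ w, fa w (Matrix.of fun i j =>
          (((((y : GL (Fin N) (mixedSpace L)) * expGL (X : Matrix (Fin N) (Fin N) (mixedSpace L)) : GL (Fin N) (mixedSpace L)) :
              Matrix (Fin N) (Fin N) (mixedSpace L)) i j).2 w))
    have hval : ContDiff ℝ ∞ fun X : (archGroupGL N L).lie.toSubmodule => (X : Matrix (Fin N) (Fin N) (mixedSpace L)) :=
      (archGroupGL N L).lie.toSubmodule.subtypeL.contDiff
    have hexp : ContDiff ℝ ∞ fun X : (archGroupGL N L).lie.toSubmodule =>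
        ((y : GL (Fin N) (mixedSpace L)) : Matrix (Fin N) (Fin N) (mixedSpace L)) * NormedSpace.exp (X : Matrix (Fin N) (Fin N) (mixedSpace L)) :=
      contDiff_const.mul (contDiff_exp_matrix_mixedSpace.comp hval)
    have h : (fun X : (archGroupGL N L).lie.toSubmodule =>
        (χ ((((y : GL (Fin N) (mixedSpace L)) * expGL (X : Matrix (Fin N) (Fin N) (mixedSpace L)) : GL (Fin N) (mixedSpace L)) :
            Matrix (Fin N) (Fin N) (mixedSpace L))) : ℂ) *
          ∏ w, fa w (Matrix.of fun i j =>
            (((((y : GL (Fin N) (mixedSpace L)) * expGL (X : Matrix (Fin N) (Fin N) (mixedSpace L)) : GL (Fin N) (mixedSpace L)) :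
                Matrix (Fin N) (Fin N) (mixedSpace L)) i j).2 w))) =
        fun X : (archGroupGL N L).lie.toSubmodule =>
          (χ (((y : GL (Fin N) (mixedSpace L)) : Matrix (Fin N) (Fin N) (mixedSpace L)) * NormedSpace.exp (X : Matrix (Fin N) (Fin N) (mixedSpace L))) : ℂ) *
            ∏ w, fa w (Matrix.of fun i j =>
              (((((y : GL (Fin N) (mixedSpace L)) : Matrix (Fin N) (Fin N) (mixedSpace L)) * NormedSpace.exp (X : Matrix (Fin N) (Fin N) (mixedSpace L))) i j).2 w)) := by
      funext X; rw [Units.val_mul, coe_expGL]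
    rw [h]
    exact ((Complex.ofRealCLM.contDiff.comp (hχ.comp hexp))).mul (hΘ.comp hexp)
  · -- restriction to `U(H)(L ⊗ ℝ)`
    show archTensor L H φ k = (χ (((k : GL (Fin N) (mixedSpace L)) : Matrix (Fin N) (Fin N) (mixedSpace L))) : ℂ) *
      ∏ w, fa w (Matrix.of fun i j => ((((k : GL (Fin N) (mixedSpace L)) : Matrix (Fin N) (Fin N) (mixedSpace L)) i j).2 w))
    rw [← archTensor_eq_ambient L H φ fa hφ k]
    by_cases hk : k ∈ tsupport ⇑(archTensor L H φ)
    · rw [hχK _ ⟨k, hk, rfl⟩, Complex.ofReal_one, one_mul]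
    · rw [image_eq_zero_of_notMem_tsupport hk, mul_zero]

/-- The same for the pure tensor with its `w`-component replaced by an ambient-smooth `ψ` (print's one-place surgery `f_{1u} ⊗ ⊗_{w ≠ u} f_w`).
[cite: BorelJacquet1979, §4.1] [cite: Rogawski1990, §13.8 p. 218 L20–28] -/
theorem archSmooth_archTensor_update [DecidableEq {w : InfinitePlace L // w.IsComplex}]
    (φ : ∀ w : {w : InfinitePlace L // w.IsComplex}, C_c(↥(archLocal L N H w), ℂ))
    (fa : ∀ w : {w : InfinitePlace L // w.IsComplex}, Matrix (Fin N) (Fin N) ℂ → ℂ) (hfa : ∀ w, ContDiff ℝ ∞ (fa w))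
    (hφ : ∀ w (g : ↥(archLocal L N H w)), φ w g = fa w ((g : GL (Fin N) ℂ) : Matrix (Fin N) (Fin N) ℂ))
    (u : {w : InfinitePlace L // w.IsComplex}) (ψ : C_c(↥(archLocal L N H u), ℂ)) (ga : Matrix (Fin N) (Fin N) ℂ → ℂ) (hga : ContDiff ℝ ∞ ga)
    (hψ : ∀ g : ↥(archLocal L N H u), ψ g = ga ((g : GL (Fin N) ℂ) : Matrix (Fin N) (Fin N) ℂ)) :
    ArchSmooth L N H ⇑(archTensor L H (Function.update φ u ψ)) := by
  refine archSmooth_archTensor L H (Function.update φ u ψ) (Function.update fa u ga) (fun w => ?_) (fun w g => ?_)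
  · by_cases h : w = u
    · subst h; rwa [Function.update_self]
    · rw [Function.update_of_ne h]; exact hfa w
  · by_cases h : w = u
    · subst h; rw [Function.update_self, Function.update_self]; exact hψ g
    · rw [Function.update_of_ne h, Function.update_of_ne h]; exact hφ w g

end Smooth

end Summit.HodgeConjecture.HodgeConjecture.R90.S2

end
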